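/-
Copyright (c) 2026. All rights reserved.
Released under Apache 2.0 license as described in the file LICENSE.
-/
import Literature.NumberTheory.Automorphic.QuaternionicSIdealClassesAdmissible
import Mathlib.Algebra.GroupWithZero.Units.Fintype
import HarnessLib

/-!
# Refining a sign pattern: `M^{χ₀}_{T₀}(O) = ⊕_{χ|_{T₀} = χ₀} M^χ_T(O)` for `T₀ ⊆ T`, and Martin's count
# `dim M^{χ₀} = dim M^χ + dim M^{χ'}` at one more prime (Martin 2018, §4.2 Lemma 5 and §4.5 Lemma 10, proofs)

[tag: quaternion_algebra] [tag: eichler_order] [tag: hecke_operator]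

Topic `NumberTheory/Automorphic`. Lane `lit-hodgefound`, seat p12, gen 52 — sequel of
`BrandtModuleSignPatternDecomposition.lean` (`ℚ^{Cls O} = ⊕_χ M^χ_T(O)`), `QuaternionicSIdealClasses.lean`
(`dim M^{+_T} = h_T`) and `QuaternionicSIdealClassesAdmissible.lean` (`dim M^χ_T = #Cl_T(O)^{χ-adm}`).

Martin uses twice the additivity of dimensions when ONE more local condition is imposed:
[Martin2018, §4.2, proof of Lemma 5] "`dim A(+_𝔭) + dim A(−_𝔭) = ∑_i dim V_k^{Γ_i} = dim M_k(O)`", and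
[Martin2018, §4.5, proof of Lemma 10] (`𝔐 = 𝔭₀ 𝔐₀`, `χ₀ = χ|_{S₀}`, `χ'` the extension of `χ₀` with `χ'_{𝔭₀} = −χ_{𝔭₀}`):
"On the other hand, we have `dim M_k^{χ₀}(O) = dim M_k^{χ}(O) + dim M_k^{χ'}(O)`."
In weight `0` (the Brandt module `ℚ^{Cls O}` of an Eichler order, every `S : XiSetup N⁺ N⁻`) this file proves, for all
finite `T₀ ⊆ T` and every `χ₀ : T₀ → {±1}`:

* §1 (generic, private) `finrank (⨆_{i ∈ s} A i) = ∑_{i ∈ s} finrank (A i)` for an independent family;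
* §2 ★ **`finrank_signSpace_eq_sum_finrank_signSpace_extension`** (`dim M^{χ₀}_{T₀}(O) = ∑_{χ : T → {±1}, χ|_{T₀} = χ₀}
  dim M^χ_T(O)`) and **`signSpace_eq_biSup_signSpace_extension`** (`M^{χ₀}_{T₀}(O) = ⊕_{χ|_{T₀} = χ₀} M^χ_T(O)`, the sum being
  direct by `iSupIndep_signSpace`), `natCard_isAdmissible_eq_sum` (the same for the numbers of admissible classes);
* §3 ONE MORE PRIME `T = T₀ ∪ {r}`, `r ∉ T₀`: ★★ **`finrank_signSpace_restrict_eq_add`** (Martin: `dim M^{χ₀} = dim M^{χ} +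
  dim M^{χ'}`, `χ' = χ` with the sign at `r` flipped), **`natCard_sClassSet_eq_natCard_sClassSet_insert_add_finrank`**
  (`h_{T₀} = h_{T₀ ∪ {r}} + dim M_T^{(+_{T₀}, −_r)}(O)` — the relative form of [Martin2018, (4.4)] `dim M_0^{−_𝔭} = s_𝔭 =
  h − h_{B,𝔭}`), `finrank_signSpace_le_finrank_signSpace_restrict` (refining a pattern can only lower the dimension), `finrank_signSpace_update_one_neg_one`, `finrank_signSpace_singleton_neg_one` ((4.4) itself).

## References

* [Martin2018] K. Martin, *Congruences for modular forms mod 2 and quaternionic `S`-ideal classes*, Canad. J. Math. 70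
  (2018) (held: arXiv 1701.07864): §4.2 (proof of Lemma 5), §4.3 (4.4), §4.5 (proof of Lemma 10).
* [Martin2018RefinedDimensions] K. Martin, *Refined dimensions of cusp forms …*, J. Number Theory 188 (2018), §3
  ("incomplete" sign patterns `ε_M`, `M ∣ N`).
* [Voight2021] J. Voight, *Quaternion Algebras*, GTM 288 (2021): (41.3.5).

## Scope (honest)

Weight `0`, `F = ℚ`, Eichler level with the level involutions admitted (as in the companion files). Theorems only; no
definition, no named fact, no instance.
-/

noncomputable section

open scoped Pointwise

namespace Literature.NumberTheory.Automorphic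

namespace Brandt

/-! ## §0 Generic: the dimension of a finite independent supremum (private) -/

section Generic

variable {V : Type*} [AddCommGroup V] [Module ℚ V] [FiniteDimensional ℚ V] {ι : Type*}

/-- `dim (⨆_{i ∈ s} A i) = ∑_{i ∈ s} dim (A i)` for an independent family of subspaces. [folklore] -/
private theorem finrank_biSup_eq_sum_of_iSupIndep [DecidableEq ι] {A : ι → Submodule ℚ V} (h : iSupIndep A)
    (s : Finset ι) : Module.finrank ℚ (⨆ i ∈ s, A i : Submodule ℚ V) = ∑ i ∈ s, Module.finrank ℚ (A i) := by
  induction s using Finset.induction_on with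
  | empty =>
    rw [Finset.sum_empty]
    have : (⨆ i ∈ (∅ : Finset ι), A i : Submodule ℚ V) = ⊥ := by simp
    rw [this, finrank_bot]
  | @insert j s hj ih =>
    rw [Finset.iSup_insert, Finset.sum_insert hj, ← ih]
    have hdisj : Disjoint (A j) (⨆ i ∈ s, A i) := by
      refine (h j).mono_right ?_
      exact iSup₂_le fun i hi => le_iSup₂_of_le i (fun h' => hj (h' ▸ hi)) le_rfl
    have key := Submodule.finrank_sup_add_finrank_inf_eq (A j) (⨆ i ∈ s, A i)
    rw [disjoint_iff.mp hdisj, finrank_bot, add_zero] at key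
    exact key

end Generic

variable {Nplus Nminus : ℕ} (S : XiSetup Nplus Nminus)

/-! ## §2 `M^{χ₀}_{T₀}(O)` is the direct sum of the `M^χ_T(O)` over the extensions `χ` of `χ₀` -/

section Refinement

variable {T₀ T : Finset ℕ} (h : T₀ ⊆ T)

/-- Each `M^χ_T(O)` with `χ|_{T₀} = χ₀` lies in `M^{χ₀}_{T₀}(O)`. [cite: Martin2018, §3.3 and §4.5 (proof of Lemma 10)] -/
theorem XiSetup.signSpace_le_signSpace_of_restrict_eq {χ₀ : T₀ → ℤˣ} {χ : T → ℤˣ}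
    (hχ : (fun i : T₀ => χ ⟨i, h i.2⟩) = χ₀) : S.signSpace T χ ≤ S.signSpace T₀ χ₀ := by
  rw [← hχ]
  exact S.signSpace_le_signSpace_of_subset h χ

/-- `⨆_{χ|_{T₀} = χ₀} M^χ_T(O) ≤ M^{χ₀}_{T₀}(O)`. [cite: Martin2018, §4.5 (proof of Lemma 10)] -/
theorem XiSetup.biSup_signSpace_extension_le [DecidableEq (T₀ → ℤˣ)] (χ₀ : T₀ → ℤˣ) :
    (⨆ χ ∈ (Finset.univ.filter fun χ : T → ℤˣ => (fun i : T₀ => χ ⟨i, h i.2⟩) = χ₀), S.signSpace T χ) ≤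
      S.signSpace T₀ χ₀ :=
  iSup₂_le fun _ hχ => S.signSpace_le_signSpace_of_restrict_eq h (Finset.mem_filter.mp hχ).2

/-- **`dim M^{χ₀}_{T₀}(O) = ∑_{χ : T → {±1}, χ|_{T₀} = χ₀} dim M^χ_T(O)`** for `T₀ ⊆ T`: imposing the conditions at the
remaining places of `T` splits a sign space into the sign spaces of the extended patterns (both gradings exhaust
`ℚ^{Cls O}`, so the obvious inclusions are equalities by counting dimensions).
[cite: Martin2018, §4.2 (proof of Lemma 5) and §4.5 (proof of Lemma 10)] [cite: Martin2018RefinedDimensions, §3] -/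
theorem XiSetup.finrank_signSpace_eq_sum_finrank_signSpace_extension [DecidableEq (T₀ → ℤˣ)] (χ₀ : T₀ → ℤˣ) :
    Module.finrank ℚ (S.signSpace T₀ χ₀) =
      ∑ χ ∈ Finset.univ.filter (fun χ : T → ℤˣ => (fun i : T₀ => χ ⟨i, h i.2⟩) = χ₀),
        Module.finrank ℚ (S.signSpace T χ) := by
  classical
  -- both sides summed over `χ₀` give `#Cls O`
  set ρ : (T → ℤˣ) → (T₀ → ℤˣ) := fun χ i => χ ⟨i, h i.2⟩ with hρ
  set f : (T₀ → ℤˣ) → ℕ := fun χ₀ => Module.finrank ℚ (S.signSpace T₀ χ₀) with hf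
  set g : (T₀ → ℤˣ) → ℕ := fun χ₀ =>
    ∑ χ ∈ Finset.univ.filter (fun χ : T → ℤˣ => ρ χ = χ₀), Module.finrank ℚ (S.signSpace T χ) with hg
  have hle : ∀ χ₀ ∈ (Finset.univ : Finset (T₀ → ℤˣ)), g χ₀ ≤ f χ₀ := fun χ₀ _ => by
    simp only [hf, hg]
    rw [← finrank_biSup_eq_sum_of_iSupIndep (S.iSupIndep_signSpace T)]
    exact Submodule.finrank_mono (S.biSup_signSpace_extension_le h χ₀)
  have hsum : ∑ χ₀, g χ₀ = ∑ χ₀, f χ₀ := by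
    simp only [hf, hg]
    rw [Finset.sum_fiberwise Finset.univ ρ fun χ => Module.finrank ℚ (S.signSpace T χ), S.sum_finrank_signSpace T,
      S.sum_finrank_signSpace T₀]
  have heq := (Finset.sum_eq_sum_iff_of_le hle).mp hsum χ₀ (Finset.mem_univ _)
  simp only [hf, hg] at heq
  exact heq.symm

/-- **`M^{χ₀}_{T₀}(O) = ⊕_{χ|_{T₀} = χ₀} M^χ_T(O)`** (as a supremum of the independent family `M^χ_T`).
[cite: Martin2018, §4.5 (proof of Lemma 10)] [cite: Voight2021, (41.3.5)] -/
theorem XiSetup.signSpace_eq_biSup_signSpace_extension [DecidableEq (T₀ → ℤˣ)] (χ₀ : T₀ → ℤˣ) :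
    S.signSpace T₀ χ₀ =
      ⨆ χ ∈ (Finset.univ.filter fun χ : T → ℤˣ => (fun i : T₀ => χ ⟨i, h i.2⟩) = χ₀), S.signSpace T χ := by
  classical
  symm
  refine Submodule.eq_of_le_of_finrank_eq (S.biSup_signSpace_extension_le h χ₀) ?_
  rw [finrank_biSup_eq_sum_of_iSupIndep (S.iSupIndep_signSpace T), S.finrank_signSpace_eq_sum_finrank_signSpace_extension h]

/-- A form of pattern `χ₀` is a (unique) sum of forms of the patterns extending `χ₀`. [cite: Martin2018, §4.5 (proof of Lemma 10)] -/
theorem XiSetup.mem_biSup_signSpace_extension_of_mem [DecidableEq (T₀ → ℤˣ)] {χ₀ : T₀ → ℤˣ} {v : ClassSet S.O → ℚ}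
    (hv : v ∈ S.signSpace T₀ χ₀) :
    v ∈ ⨆ χ ∈ (Finset.univ.filter fun χ : T → ℤˣ => (fun i : T₀ => χ ⟨i, h i.2⟩) = χ₀), S.signSpace T χ := by
  rwa [← S.signSpace_eq_biSup_signSpace_extension h]

/-- `dim M^χ_T(O) ≤ dim M^{χ|_{T₀}}_{T₀}(O)`: refining a sign pattern can only lower the dimension. [cite: Martin2018, §4.5] -/
theorem XiSetup.finrank_signSpace_le_finrank_signSpace_restrict (χ : T → ℤˣ) :
    Module.finrank ℚ (S.signSpace T χ) ≤ Module.finrank ℚ (S.signSpace T₀ fun i : T₀ => χ ⟨i, h i.2⟩) :=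
  Submodule.finrank_mono (S.signSpace_le_signSpace_of_subset h χ)

/-- **`#Cl_{T₀}(O)^{χ₀-adm} = ∑_{χ|_{T₀} = χ₀} #Cl_T(O)^{χ-adm}`** (Prop. 7 on both sides of the refinement).
[cite: Martin2018, §4.4 Prop. 7 and §4.5 (proof of Lemma 10)] -/
theorem XiSetup.natCard_isAdmissible_eq_sum [DecidableEq (T₀ → ℤˣ)] (χ₀ : T₀ → ℤˣ) :
    Nat.card {X : S.SClassSet T₀ // S.IsAdmissible T₀ χ₀ X} =
      ∑ χ ∈ Finset.univ.filter (fun χ : T → ℤˣ => (fun i : T₀ => χ ⟨i, h i.2⟩) = χ₀),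
        Nat.card {X : S.SClassSet T // S.IsAdmissible T χ X} := by
  rw [← S.finrank_signSpace_eq_natCard_isAdmissible χ₀, S.finrank_signSpace_eq_sum_finrank_signSpace_extension h]
  exact Finset.sum_congr rfl fun χ _ => S.finrank_signSpace_eq_natCard_isAdmissible χ

/-- **`h_{T₀} = ∑_{χ|_{T₀} = +} dim M^χ_T(O)`**: the `T₀`-class number split over the patterns at the places of `T ∖ T₀`.
[cite: Martin2018, §3.3 (3.9) and §4.5] -/
theorem XiSetup.natCard_sClassSet_eq_sum_finrank [DecidableEq (T₀ → ℤˣ)] :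
    Nat.card (S.SClassSet T₀) =
      ∑ χ ∈ Finset.univ.filter (fun χ : T → ℤˣ => (fun i : T₀ => χ ⟨i, h i.2⟩) = 1),
        Module.finrank ℚ (S.signSpace T χ) := by
  rw [← S.finrank_signSpace_one_eq_natCard_sClassSet T₀]
  exact S.finrank_signSpace_eq_sum_finrank_signSpace_extension h 1

end Refinement

/-! ## §3 One more prime: `dim M^{χ₀} = dim M^χ + dim M^{χ'}` -/

section Insert

variable {T₀ : Finset ℕ} {r : ℕ}

/-- `χ ≠ χ'` (the flip changes the sign at `r`). [folklore] -/
private theorem ne_update_neg (χ : ↥(insert r T₀) → ℤˣ) :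
    χ ≠ Function.update χ ⟨r, Finset.mem_insert_self r T₀⟩ (-χ ⟨r, Finset.mem_insert_self r T₀⟩) := by
  intro h
  have := congrFun h ⟨r, Finset.mem_insert_self r T₀⟩
  rw [Function.update_self] at this
  rcases Int.units_eq_one_or (χ ⟨r, Finset.mem_insert_self r T₀⟩) with h1 | h1 <;> rw [h1] at this <;>
    exact absurd this (by decide)

variable (hr : r ∉ T₀)
include hr

/-- The two extensions of `χ|_{T₀}` to `T₀ ∪ {r}` are `χ` and `χ` with the sign at `r` flipped: the fibre of the
restriction map over `χ|_{T₀}`. [cite: Martin2018, §4.5 (proof of Lemma 10: "`χ'` the extension of `χ₀` such that `χ'_{𝔭₀} = −χ_{𝔭₀}`")] -/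
theorem filter_restrict_insert_eq_pair [DecidableEq (T₀ → ℤˣ)] (χ : ↥(insert r T₀) → ℤˣ) :
    (Finset.univ.filter fun χ' : ↥(insert r T₀) → ℤˣ =>
        (fun i : T₀ => χ' ⟨i, Finset.mem_insert_of_mem i.2⟩) = fun i : T₀ => χ ⟨i, Finset.mem_insert_of_mem i.2⟩) =
      {χ, Function.update χ ⟨r, Finset.mem_insert_self r T₀⟩ (-χ ⟨r, Finset.mem_insert_self r T₀⟩)} := by
  classical
  set r₀ : ↥(insert r T₀) := ⟨r, Finset.mem_insert_self r T₀⟩ with hr₀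
  ext χ'
  simp only [Finset.mem_filter, Finset.mem_univ, true_and, Finset.mem_insert, Finset.mem_singleton]
  constructor
  · intro hres
    -- `χ'` agrees with `χ` off `r₀`; at `r₀` it is `± χ r₀`
    have hoff : ∀ i : ↥(insert r T₀), i ≠ r₀ → χ' i = χ i := by
      intro i hi
      have hiT : (i : ℕ) ∈ T₀ := by
        rcases Finset.mem_insert.mp i.2 with h | h
        · exact absurd (Subtype.ext h) hi
        · exact h
      have := congrFun hres ⟨i, hiT⟩
      exact this
    rcases Int.units_eq_one_or (χ' r₀ * χ r₀) with h1 | h1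
    · left
      funext i
      by_cases hi : i = r₀
      · rw [hi]
        calc χ' r₀ = χ' r₀ * (χ r₀ * χ r₀) := by rw [Int.units_mul_self, mul_one]
          _ = χ r₀ := by rw [← mul_assoc, h1, one_mul]
      · exact hoff i hi
    · right
      funext i
      by_cases hi : i = r₀
      · rw [hi, Function.update_self]
        calc χ' r₀ = χ' r₀ * (χ r₀ * χ r₀) := by rw [Int.units_mul_self, mul_one]
          _ = -χ r₀ := by rw [← mul_assoc, h1, neg_one_mul]
      · rw [Function.update_of_ne hi]; exact hoff i hi
  · rintro (rfl | rfl)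
    · rfl
    · funext i
      have hi : (⟨(i : ℕ), Finset.mem_insert_of_mem i.2⟩ : ↥(insert r T₀)) ≠ r₀ := by
        intro h
        have : (i : ℕ) = r := congrArg Subtype.val h
        exact hr (this ▸ i.2)
      exact Function.update_of_ne hi _ _

/-- **MARTIN: `dim M^{χ₀}_{T₀}(O) = dim M^{χ}_{T}(O) + dim M^{χ'}_{T}(O)`** for `T = T₀ ∪ {r}` (`r ∉ T₀`), `χ₀ = χ|_{T₀}` and
`χ'` the other extension of `χ₀` (sign at `r` flipped) — every Eichler order of a definite quaternion algebra over `ℚ`,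
weight `0`. [cite: Martin2018, §4.5 (proof of Lemma 10) and §4.2 (proof of Lemma 5)] -/
theorem XiSetup.finrank_signSpace_restrict_eq_add (χ : ↥(insert r T₀) → ℤˣ) :
    Module.finrank ℚ (S.signSpace T₀ fun i : T₀ => χ ⟨i, Finset.mem_insert_of_mem i.2⟩) =
      Module.finrank ℚ (S.signSpace (insert r T₀) χ) +
        Module.finrank ℚ (S.signSpace (insert r T₀)
          (Function.update χ ⟨r, Finset.mem_insert_self r T₀⟩ (-χ ⟨r, Finset.mem_insert_self r T₀⟩))) := by
  classical
  rw [S.finrank_signSpace_eq_sum_finrank_signSpace_extension (Finset.subset_insert r T₀),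
    filter_restrict_insert_eq_pair hr χ, Finset.sum_pair (ne_update_neg χ)]

/-- `M^{χ₀}_{T₀}(O) = M^χ_T(O) ⊔ M^{χ'}_T(O)`, the two pieces being disjoint. [cite: Martin2018, §4.5 (proof of Lemma 10)] -/
theorem XiSetup.signSpace_restrict_eq_sup (χ : ↥(insert r T₀) → ℤˣ) :
    (S.signSpace T₀ fun i : T₀ => χ ⟨i, Finset.mem_insert_of_mem i.2⟩) =
      S.signSpace (insert r T₀) χ ⊔
        S.signSpace (insert r T₀)
          (Function.update χ ⟨r, Finset.mem_insert_self r T₀⟩ (-χ ⟨r, Finset.mem_insert_self r T₀⟩)) := by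
  classical
  rw [S.signSpace_eq_biSup_signSpace_extension (Finset.subset_insert r T₀), filter_restrict_insert_eq_pair hr χ,
    Finset.iSup_insert, Finset.iSup_singleton]

omit hr in
/-- The two pieces are disjoint. [cite: Martin2018, §4.5] -/
theorem XiSetup.disjoint_signSpace_update_neg (χ : ↥(insert r T₀) → ℤˣ) :
    Disjoint (S.signSpace (insert r T₀) χ)
      (S.signSpace (insert r T₀)
        (Function.update χ ⟨r, Finset.mem_insert_self r T₀⟩ (-χ ⟨r, Finset.mem_insert_self r T₀⟩))) :=
  S.disjoint_signSpace (insert r T₀) (ne_update_neg χ)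

/-- **`h_{T₀} = h_{T₀ ∪ {r}} + dim M^{(+_{T₀}, −_r)}_{T₀ ∪ {r}}(O)`** (`r ∉ T₀`): the relative form of Martin's (4.4)
`dim M_0^{−_𝔭}(O) = s_𝔭 = h − h_{B,𝔭}` — the number of `T₀`-classes is the number of `T₀ ∪ {r}`-classes plus the
dimension of the space of forms even at `T₀` and odd at `r`. [cite: Martin2018, §4.3 (4.4) and §3.3 (3.9)] -/
theorem XiSetup.natCard_sClassSet_eq_natCard_sClassSet_insert_add_finrank :
    Nat.card (S.SClassSet T₀) =
      Nat.card (S.SClassSet (insert r T₀)) +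
        Module.finrank ℚ (S.signSpace (insert r T₀) (Function.update 1 ⟨r, Finset.mem_insert_self r T₀⟩ (-1))) := by
  have h := S.finrank_signSpace_restrict_eq_add hr (1 : ↥(insert r T₀) → ℤˣ)
  have h1 : (fun i : T₀ => (1 : ↥(insert r T₀) → ℤˣ) ⟨i, Finset.mem_insert_of_mem i.2⟩) = 1 := rfl
  rw [h1, S.finrank_signSpace_one_eq_natCard_sClassSet, S.finrank_signSpace_one_eq_natCard_sClassSet, Pi.one_apply] at h
  exact h

/-- **`dim M^{(+_{T₀}, −_r)}(O) = h_{T₀} − h_{T₀ ∪ {r}}`** (`r ∉ T₀`). [cite: Martin2018, §4.3 (4.4)] -/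
theorem XiSetup.finrank_signSpace_update_one_neg_one :
    Module.finrank ℚ (S.signSpace (insert r T₀) (Function.update 1 ⟨r, Finset.mem_insert_self r T₀⟩ (-1))) =
      Nat.card (S.SClassSet T₀) - Nat.card (S.SClassSet (insert r T₀)) := by
  have h := S.natCard_sClassSet_eq_natCard_sClassSet_insert_add_finrank hr
  omega

omit hr in
/-- Martin's (4.4) itself (`T₀ = ∅`): `dim M^{−_r}_{{r}}(O) = h − h_{{r}}` (`= s_r`, the number of orbits of size `2` of
`W_r`). [cite: Martin2018, §4.3 (4.4)] -/
theorem XiSetup.finrank_signSpace_singleton_neg_one (r : ℕ) :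
    Module.finrank ℚ (S.signSpace ({r} : Finset ℕ) (-1)) =
      Nat.card (ClassSet S.O) - Nat.card (S.SClassSet {r}) := by
  classical
  have hsum := S.sum_finrank_signSpace {r}
  -- the two sign patterns on `{r}`
  set r₀ : ({r} : Finset ℕ) := ⟨r, Finset.mem_singleton_self r⟩ with hr₀
  have huniv : (Finset.univ : Finset (({r} : Finset ℕ) → ℤˣ)) = {1, -1} := by
    apply Finset.eq_of_subset_of_card_le
    · intro χ _
      rw [Finset.mem_insert, Finset.mem_singleton]
      rcases Int.units_eq_one_or (χ r₀) with h1 | h1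
      · left
        funext i
        have hi : i = r₀ := Subtype.ext (Finset.mem_singleton.mp i.2)
        rw [hi, h1, Pi.one_apply]
      · right
        funext i
        have hi : i = r₀ := Subtype.ext (Finset.mem_singleton.mp i.2)
        rw [hi, h1, Pi.neg_apply, Pi.one_apply]
    · rw [Finset.card_univ, Fintype.card_fun, Fintype.card_units_int, Fintype.card_coe, Finset.card_singleton, pow_one]
      exact Finset.card_le_two
  have hne : (1 : ({r} : Finset ℕ) → ℤˣ) ≠ -1 := by
    intro h1
    have := congrFun h1 r₀
    rw [Pi.one_apply, Pi.neg_apply, Pi.one_apply] at this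
    exact absurd this (by decide)
  rw [huniv, Finset.sum_pair hne, S.finrank_signSpace_one_eq_natCard_sClassSet] at hsum
  omega

end Insert

end Brandt

end Literature.NumberTheory.Automorphic
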